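import Summits.Ventures.HodgeRepro2.T5SelfDualLatticeDet
import Mathlib.NumberTheory.Cyclotomic.Basic
import Mathlib.RingTheory.Polynomial.Cyclotomic.Roots

/-!
# Non-vacuity of `T5SelfDualLatticeDet`: the toy `ℚ(ζ₄)/ℚ` over `ℤ` (Tier-5 support, N3)

The hypotheses of `T5SelfDualLatticeDet.exists_dualLattice_eq_iff_det_eq_mul_norm_quadratic` are
jointly satisfied by `R₀ = ℤ`, `F = ℚ`, `E = ℚ(ζ₄)` (Mathlib's `CyclotomicField 4 ℚ`, of degree
`φ(4) = 2`, Galois, with its non-trivial automorphism), `H = antidiag(1, 1, 1)` (hermitian, of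
determinant `−1`) and the isotropic vector `e = (1, 0, 0)`; on this instance the criterion holds
(`det H = −1 = (−1) · N(1)`), so `(E³, H)` admits a self-dual `𝒪_E`-lattice — the standard
lattice itself. Referee protocol README §10.5 (ii)(c)/(d): the carrier is inhabited and the
hypotheses instantiate simultaneously. No L-value anywhere (README §8(d): NO).
-/

namespace Summit.Ventures.HodgeRepro2.T5SelfDualLatticeToy

open T5UnitaryGroupIsometry T5HermitianThreeElements T5SelfDualLatticeDet

-- The structural `ℚ`-algebra of `CyclotomicField 4 ℚ` (the one `IsCyclotomicExtension` and
-- `CyclotomicField.instAlgebra ℤ` are stated for), ahead of `DivisionRing.toRatAlgebra`.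
attribute [local instance 1100] CyclotomicField.algebra

/-- The toy field `E := ℚ(ζ₄)`. -/
local notation "E₄" => CyclotomicField 4 ℚ

/-- `[ℚ(ζ₄) : ℚ] = 2`. -/
theorem finrank_toy : Module.finrank ℚ E₄ = 2 := by
  rw [IsCyclotomicExtension.finrank (n := 4) E₄
    (Polynomial.cyclotomic.irreducible_rat (by norm_num : 0 < 4))]
  decide

/-- `ℚ(ζ₄)/ℚ` is Galois. -/
theorem isGalois_toy : IsGalois ℚ E₄ := IsCyclotomicExtension.isGalois {4} ℚ E₄

/-- The non-trivial automorphism of `ℚ(ζ₄)/ℚ` exists. -/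
theorem exists_algEquiv_ne_one_toy : ∃ σ : E₄ ≃ₐ[ℚ] E₄, σ ≠ 1 :=
  haveI := isGalois_toy
  T5StarOfInvolution.exists_ne_one_of_finrank_eq_two finrank_toy

/-- `antidiag(1, 1, 1)` is hermitian for any star. -/
theorem isHermitian_J3_one [StarRing E₄] : (J3 (1 : E₄)).IsHermitian := by
  ext i j
  simp only [Matrix.conjTranspose_apply, J3, T5AntidiagonalForm.antidiagonalMatrix, Matrix.of_apply]
  fin_cases i <;> fin_cases j <;> simp [Fin.rev, Fin.ext_iff]

/-- `det antidiag(1, 1, 1) = −1` is a unit. -/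
theorem isUnit_det_J3_one : IsUnit (J3 (1 : E₄)).det := by
  rw [T5HermitianIsotropicForm.det_J3]
  exact isUnit_one.neg

/-- `e = (1, 0, 0)` is isotropic for `antidiag(1, 1, 1)`. -/
theorem sesqForm_J3_one_single [StarRing E₄] :
    sesqForm (J3 (1 : E₄)) (Pi.single 0 1) (Pi.single 0 1) = 0 := by
  simp only [sesqForm_apply, Fin.sum_univ_three, J3, T5AntidiagonalForm.antidiagonalMatrix,
    Matrix.of_apply]
  simp [Fin.rev, Fin.ext_iff]

/-- **Non-vacuity.** On the toy `(ℤ, ℚ, ℚ(ζ₄), σ, antidiag(1,1,1))` the equivalence of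
`T5SelfDualLatticeDet` applies and both sides hold: `det H = −1 = (−1) · σ 1 · 1`, so `(E³, H)`
admits a self-dual `𝒪_E`-lattice. -/
theorem exists_dualLattice_eq_toy (σ : E₄ ≃ₐ[ℚ] E₄) (hσ : σ ≠ 1) :
    letI := T5StarOfInvolution.starRingOfQuadratic finrank_toy σ hσ
    ∃ Q : Matrix (Fin 3) (Fin 3) E₄, IsUnit Q ∧
      dualLattice (integralClosure ℤ E₄) (Q.conjTranspose * J3 (1 : E₄) * Q)
        (stdLattice (integralClosure ℤ E₄)) = stdLattice (integralClosure ℤ E₄) := by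
  letI := T5StarOfInvolution.starRingOfQuadratic finrank_toy σ hσ
  rw [exists_dualLattice_eq_iff_det_eq_mul_norm_quadratic finrank_toy σ hσ isHermitian_J3_one
    isUnit_det_J3_one two_ne_zero (e := Pi.single 0 1) (by simp) sesqForm_J3_one_single]
  refine ⟨-1, 1, one_ne_zero, ?_⟩
  rw [T5HermitianIsotropicForm.det_J3, map_one, mul_one, Units.val_neg, Units.val_one, map_neg,
    map_one, mul_one]

/-- The toy's non-trivial automorphism, packaged: the statement above holds for some `σ`. -/
theorem exists_exists_dualLattice_eq_toy :
    ∃ (σ : E₄ ≃ₐ[ℚ] E₄) (hσ : σ ≠ 1),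
      letI := T5StarOfInvolution.starRingOfQuadratic finrank_toy σ hσ
      ∃ Q : Matrix (Fin 3) (Fin 3) E₄, IsUnit Q ∧
        dualLattice (integralClosure ℤ E₄) (Q.conjTranspose * J3 (1 : E₄) * Q)
          (stdLattice (integralClosure ℤ E₄)) = stdLattice (integralClosure ℤ E₄) := by
  obtain ⟨σ, hσ⟩ := exists_algEquiv_ne_one_toy
  exact ⟨σ, hσ, exists_dualLattice_eq_toy σ hσ⟩

end Summit.Ventures.HodgeRepro2.T5SelfDualLatticeToy
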